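import Literature.AnabelianGeometry.SemiGraphs.FiniteEtaleCoveringVertexAligned
import Literature.AnabelianGeometry.SemiGraphs.ProfiniteHomToAnab
import Literature.AnabelianGeometry.SemiGraphs.ZariskiMainTheorem

/-!
# Vertex alignment is a CONDITION on a morphism, not a property of every morphism
# ([SemiAnbd] §2 p. 23, Rem. 2.2.1 p. 24) — the universal closure of `Hom.IsVertexAligned` refuted

Mochizuki, *Semi-graphs of anabelioids*, Publ. RIMS **42** (2006) 221–322, §2 p. 23 and
Remark 2.2.1 p. 24 [cite: MochizukiSemiAnbd2006, Rem. 2.2.1 p.24].  The tree's predicate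
`Hom.IsVertexAligned φ` (`FiniteEtaleCoveringVertexAligned.lean`, abc-iut-L6-d4, ruling ρ2) types
"the verticial subgroups of the covering are the decomposition groups `Π′ ∩ g⁻¹ Π_v g`" for an
ARBITRARY morphism `φ : 𝒢′ → 𝒢`.  Its instance form at print's construction is a theorem
(`BObj.coveringHomCan_isVertexAligned`, `CoveringOfObjectVertexAligned.lean`); this PROOF-ONLY
file records that the predicate is NOT universally valid (abc-iut FACT-LIST row F-2531:
«universal closure REFUTED; instance form PROVED»).

The witness (`Hom.not_forall_isVertexAligned`).  Target `𝒢`: the bouquet `H_1` (one vertex `v`,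
one loop `e`), all constituents `B(ℤ/2)`, branch maps the identity — so an object of `B(𝒢)` is a
finite `ℤ/2`-set `S` with two equivariant identifications `ψ_f, ψ_t : S ⥲ T`.  Source `𝒢′`: the
bouquet `H_2` (loops `e₀, e₁`), all constituents `B(ℤ/2)`, branch maps TRIVIAL.  The morphism
`φ : 𝒢′ → 𝒢` collapses both loops onto `e`, has TRIVIAL vertex and edge components
`φ_v = φ_e = B(ℤ/2 → 1 → ℤ/2)`, and its 2-cells `φ_b` (isomorphisms between restriction functors
along trivial homomorphisms, i.e. natural permutations of underlying sets — `resIsoOfConj`) are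
"act by `k⁻¹`" (`k` the generator) at the branch `(e₀,f)` and the identity at
`(e₀,t), (e₁,f), (e₁,t)`.  Clause (a) of vertex alignment, `ι(Π_{v′}) = ι(Π_{𝒢′}) ∩ Π_v`
(`ι = π₁(φ^*)` at the forgetful basepoints), then fails: every element of `ι(Π_{v′})` is trivial
(`φ_v` trivial, `π₁(B(ℤ/2)) = ℤ/2` acts through `φ_v`), but the "monodromy quotient"
`x := μ₀ · μ₁⁻¹ ∈ Π_{𝒢′}` (`μ_i(S′) = ψ′_{i,f} ψ′_{i,t}⁻¹`, a natural permutation of the vertex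
fibre) maps to `ι(x) = ` "act by `k⁻¹`" `∈ Π_v` (KEY COMPUTATION, pointwise on the gluings of
`φ^* A`), which is trivial on no `B(ℤ/2)`-object with a moved point (`π₁(B(ℤ/2)) = ℤ/2`).
Nothing here bears on [IUTchIII] Cor. 3.12; no side is taken.  No definitions, no facts.
-/

namespace Literature.AnabelianGeometry.SemiGraphs

open CategoryTheory CategoryTheory.Limits CategoryTheory.PreGaloisCategory
open Literature.AnabelianGeometry.Anabelioids
open Literature.AlgebraicGeometry.Frobenioids (BCat)
open scoped FintypeCatDiscrete Pointwise

namespace SemiGraphOfAnabelioids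

/-- **The universal closure of `Hom.IsVertexAligned` is false** (abc-iut FACT-LIST row F-2531: the
row is a PREDICATE — [SemiAnbd] §2 p. 23 / Rem. 2.2.1 p. 24 give it for the covering CONSTRUCTED
from an object of `B(𝒢)`, where it is the theorem `BObj.coveringHomCan_isVertexAligned`, not for
every morphism): the collapse `H_2 → H_1` over `B(ℤ/2)` with trivial components and one twisted
2-cell violates clause (a). [cite: MochizukiSemiAnbd2006, Rem. 2.2.1 p.24] -/
theorem Hom.not_forall_isVertexAligned :
    ¬ ∀ (𝒢 𝒢' : SemiGraphOfAnabelioids.{0, 1, 0}) (φ : Hom 𝒢' 𝒢), φ.IsVertexAligned := by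
  intro h
  -- the trivial homomorphism and the twist
  let t : Multiplicative (ZMod 2) →ₜ* Multiplicative (ZMod 2) := 1
  let k : Multiplicative (ZMod 2) := Multiplicative.ofAdd 1
  have hk : k ≠ 1 := by decide
  -- target: `H_1`, all `B(ℤ/2)`, identity branch maps
  let 𝔊 : SemiGraphOfGroups (SemiGraph.bouquet.{0} 1) :=
    { GV := fun _ => Multiplicative (ZMod 2)
      GE := fun _ => Multiplicative (ZMod 2)
      hom := fun _ _ _ => ContinuousMonoidHom.id _ }
  -- source: `H_2`, all `B(ℤ/2)`, trivial branch maps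
  let 𝔊' : SemiGraphOfGroups (SemiGraph.bouquet.{0} 2) :=
    { GV := fun _ => Multiplicative (ZMod 2)
      GE := fun _ => Multiplicative (ZMod 2)
      hom := fun _ _ _ => t }
  -- the collapse `H_2 → H_1`
  let c : SemiGraph.bouquet.{0} 2 ⟶ SemiGraph.bouquet.{0} 1 :=
    { vertexMap := fun v => v
      edgeMap := fun _ => ⟨0⟩
      branchMap := fun b => ⟨(0, b.down.2)⟩
      edgeOf_branchMap := fun _ => rfl
      branchMap_injOn := fun b₁ b₂ he hb => by
        have h1 : b₁.down.1 = b₂.down.1 := congrArg ULift.down he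
        have h2 : b₁.down.2 = b₂.down.2 := congrArg (fun b : (SemiGraph.bouquet.{0} 1).Branch => b.down.2) hb
        exact congrArg ULift.up (Prod.ext h1 h2)
      abuts_branchMap := fun _ _ h => h }
  -- the twist: `k` at the branch `(e₀, f)`, `1` elsewhere
  let tw : (SemiGraph.bouquet.{0} 2).Branch → Multiplicative (ZMod 2) :=
    fun b => match b.down.1.val, b.down.2 with
      | 0, false => k
      | _, _ => 1
  have htw : ∀ (b : (SemiGraph.bouquet.{0} 2).Branch) (x : Multiplicative (ZMod 2)),
      (t.comp t) x = tw b * ((ContinuousMonoidHom.id _).comp t) x * (tw b)⁻¹ := by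
    intro b x
    change (1 : Multiplicative (ZMod 2)) = tw b * 1 * (tw b)⁻¹
    rw [mul_one, mul_inv_cancel]
  let φ : Hom 𝔊'.toAnabelioids 𝔊.toAnabelioids :=
    { base := c
      φV := fun _ => bCatMap t
      φE := fun _ _ _ => bCatMap t
      φB := fun b _ _ =>
        (ContAction.resComp FintypeCat.{0} t t).symm ≪≫
          resIsoOfConj _ _ (tw b) (htw b) ≪≫
          ContAction.resComp FintypeCat.{0} t (ContinuousMonoidHom.id _) }
  -- vertices, branches, forgetful basepoints
  let v₀' : 𝔊'.toAnabelioids.graph.Vertex := PUnit.unit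
  let v₀ : 𝔊.toAnabelioids.graph.Vertex := φ.base.vertexMap v₀'
  let F' : 𝔊'.toAnabelioids.V v₀' ⥤ FintypeCat.{0} :=
    ObjectProperty.ι (Action.IsContinuous (V := FintypeCat.{0}) (G := Multiplicative (ZMod 2))) ⋙
      Action.forget FintypeCat.{0} (Multiplicative (ZMod 2))
  haveI hF' : FiberFunctor F' := fiberFunctor_forget_bCat (Multiplicative (ZMod 2))
  let F : 𝔊.toAnabelioids.V v₀ ⥤ FintypeCat.{0} :=
    ObjectProperty.ι (Action.IsContinuous (V := FintypeCat.{0}) (G := Multiplicative (ZMod 2))) ⋙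
      Action.forget FintypeCat.{0} (Multiplicative (ZMod 2))
  haveI hF : FiberFunctor F := fiberFunctor_forget_bCat (Multiplicative (ZMod 2))
  let e₀ : (φ.φV v₀').pullback ⋙ F' ≅ F := Iso.refl _
  obtain ⟨ha, -⟩ := h _ _ φ v₀' F' F e₀
  -- the forgetful functors on the edge anabelioids `B(ℤ/2)` of the source, the branches of `H_2`
  let Fe' : ∀ e : 𝔊'.toAnabelioids.graph.Edge, 𝔊'.toAnabelioids.E e ⥤ FintypeCat.{0} := fun _ =>
    ObjectProperty.ι (Action.IsContinuous (V := FintypeCat.{0}) (G := Multiplicative (ZMod 2))) ⋙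
      Action.forget FintypeCat.{0} (Multiplicative (ZMod 2))
  let bf : Fin 2 → 𝔊'.toAnabelioids.graph.Branch := fun i => ⟨(i, false)⟩
  let bt : Fin 2 → 𝔊'.toAnabelioids.graph.Branch := fun i => ⟨(i, true)⟩
  have hbf : ∀ i, 𝔊'.toAnabelioids.graph.abuts (bf i) = some v₀' := fun _ => rfl
  have hbt : ∀ i, 𝔊'.toAnabelioids.graph.abuts (bt i) = some v₀' := fun _ => rfl
  -- the monodromy of an object of `B(𝒢′)` around the loop `e_i`, on the vertex fibre
  let μ : ∀ (i : Fin 2) (A' : 𝔊'.toAnabelioids.BObj),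
      (Fe' _).obj ((𝔊'.toAnabelioids.pull (bf i) v₀' (hbf i)).pullback.obj (A'.S v₀')) ≅
        (Fe' _).obj ((𝔊'.toAnabelioids.pull (bt i) v₀' (hbt i)).pullback.obj (A'.S v₀')) :=
    fun i A' => (Fe' _).mapIso (A'.ψ (bf i) v₀' (hbf i)) ≪≫ ((Fe' _).mapIso (A'.ψ (bt i) v₀' (hbt i))).symm
  have hμ : ∀ (i : Fin 2) {A' B' : 𝔊'.toAnabelioids.BObj} (f : A' ⟶ B'),
      (Fe' _).map ((𝔊'.toAnabelioids.pull (bf i) v₀' (hbf i)).pullback.map (f.fS v₀')) ≫ (μ i B').hom =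
        (μ i A').hom ≫ (Fe' _).map ((𝔊'.toAnabelioids.pull (bt i) v₀' (hbt i)).pullback.map (f.fS v₀')) := by
    intro i A' B' f
    have cf : (Fe' _).map ((𝔊'.toAnabelioids.pull (bf i) v₀' (hbf i)).pullback.map (f.fS v₀')) ≫
        (Fe' _).map (B'.ψ (bf i) v₀' (hbf i)).hom =
          (Fe' _).map (A'.ψ (bf i) v₀' (hbf i)).hom ≫ (Fe' _).map (f.fT _) := by
      simpa only [Functor.map_comp] using congrArg (Fe' _).map (f.comm (bf i) v₀' (hbf i))
    have ct : (Fe' _).map ((𝔊'.toAnabelioids.pull (bt i) v₀' (hbt i)).pullback.map (f.fS v₀')) ≫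
        (Fe' _).map (B'.ψ (bt i) v₀' (hbt i)).hom =
          (Fe' _).map (A'.ψ (bt i) v₀' (hbt i)).hom ≫ (Fe' _).map (f.fT _) := by
      simpa only [Functor.map_comp] using congrArg (Fe' _).map (f.comm (bt i) v₀' (hbt i))
    dsimp only [μ]
    rw [Iso.trans_hom, Iso.trans_hom, Iso.symm_hom, Iso.symm_hom, Functor.mapIso_hom,
      Functor.mapIso_hom, ← Category.assoc, cf, Category.assoc, Category.assoc]
    congr 1
    rw [Iso.comp_inv_eq, Category.assoc, Iso.eq_inv_comp]
    exact ct.symm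
  have hμ' : ∀ (i : Fin 2) {A' B' : 𝔊'.toAnabelioids.BObj} (f : A' ⟶ B'),
      (Fe' _).map ((𝔊'.toAnabelioids.pull (bt i) v₀' (hbt i)).pullback.map (f.fS v₀')) ≫ (μ i B').inv =
        (μ i A').inv ≫ (Fe' _).map ((𝔊'.toAnabelioids.pull (bf i) v₀' (hbf i)).pullback.map (f.fS v₀')) := by
    intro i A' B' f
    rw [Iso.comp_inv_eq, Category.assoc, Iso.eq_inv_comp]
    exact (hμ i f).symm
  -- the monodromy quotient `x = μ₀ μ₁⁻¹ ∈ Π_{𝒢′}`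
  let x : Aut (𝔊'.toAnabelioids.ρ v₀' ⋙ F') :=
    NatIso.ofComponents
      (fun A' => (μ 0 A' ≪≫ (μ 1 A').symm :
        (𝔊'.toAnabelioids.ρ v₀' ⋙ F').obj A' ≅ (𝔊'.toAnabelioids.ρ v₀' ⋙ F').obj A'))
      (fun {A' B'} f => by
        change (Fe' _).map ((𝔊'.toAnabelioids.pull (bf 0) v₀' (hbf 0)).pullback.map (f.fS v₀')) ≫
            (μ 0 B').hom ≫ (μ 1 B').inv =
          ((μ 0 A').hom ≫ (μ 1 A').inv) ≫
            (Fe' _).map ((𝔊'.toAnabelioids.pull (bf 1) v₀' (hbf 1)).pullback.map (f.fS v₀'))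
        rw [← Category.assoc, hμ 0 f, Category.assoc, Category.assoc]
        congr 1
        exact hμ' 1 f)
  -- the branches of the target loop
  let b₁f : 𝔊.toAnabelioids.graph.Branch := ⟨(0, false)⟩
  let b₁t : 𝔊.toAnabelioids.graph.Branch := ⟨(0, true)⟩
  have hb₁f : 𝔊.toAnabelioids.graph.abuts b₁f = some v₀ := rfl
  have hb₁t : 𝔊.toAnabelioids.graph.abuts b₁t = some v₀ := rfl
  -- name the homomorphism `ι = π₁(φ^*)` (at the forgetful basepoints, `e = 1`)
  set ι := (Aut.autMulEquivOfIso ((𝔊.toAnabelioids.ρ (φ.base.vertexMap v₀')).isoWhiskerLeft e₀)).toMonoidHom.comp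
    (pi1Map φ.pullbackFunctor (𝔊'.toAnabelioids.ρ v₀' ⋙ F'))
  -- pointwise gluings of a pulled-back object along the four branches of `H_2`
  have g0f : ∀ (A : 𝔊.toAnabelioids.BObj) (z : (A.S v₀).obj.V),
      ((φ.pullbackFunctor.obj A).ψ (bf 0) v₀' (hbf 0)).hom.hom.hom z =
        (A.ψ b₁f v₀ hb₁f).hom.hom.hom (k⁻¹ • z) := fun A z => rfl
  have g1t : ∀ (A : 𝔊.toAnabelioids.BObj) (z : (A.S v₀).obj.V),
      ((φ.pullbackFunctor.obj A).ψ (bt 1) v₀' (hbt 1)).hom.hom.hom z =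
        (A.ψ b₁t v₀ hb₁t).hom.hom.hom ((1 : Multiplicative (ZMod 2))⁻¹ • z) := fun A z => rfl
  have g0t : ∀ (A : 𝔊.toAnabelioids.BObj) (w : (A.T (𝔊.toAnabelioids.graph.edgeOf b₁t)).obj.V),
      ((φ.pullbackFunctor.obj A).ψ (bt 0) v₀' (hbt 0)).inv.hom.hom w =
        (1 : Multiplicative (ZMod 2))⁻¹⁻¹ • (A.ψ b₁t v₀ hb₁t).inv.hom.hom w := fun A w => rfl
  have g1f : ∀ (A : 𝔊.toAnabelioids.BObj) (w : (A.T (𝔊.toAnabelioids.graph.edgeOf b₁f)).obj.V),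
      ((φ.pullbackFunctor.obj A).ψ (bf 1) v₀' (hbf 1)).inv.hom.hom w =
        (1 : Multiplicative (ZMod 2))⁻¹⁻¹ • (A.ψ b₁f v₀ hb₁f).inv.hom.hom w := fun A w => rfl
  -- KEY COMPUTATION: `ι(x)` acts on the vertex fibre of every `A ∈ B(𝒢)` by `k⁻¹`
  have key : ∀ (A : 𝔊.toAnabelioids.BObj) (z : (A.S v₀).obj.V), ((ι x).hom.app A) z = k⁻¹ • z := by
    intro A z
    have e1 : ((ι x).hom.app A) z =
        ((φ.pullbackFunctor.obj A).ψ (bf 1) v₀' (hbf 1)).inv.hom.hom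
          (((φ.pullbackFunctor.obj A).ψ (bt 1) v₀' (hbt 1)).hom.hom.hom
            (((φ.pullbackFunctor.obj A).ψ (bt 0) v₀' (hbt 0)).inv.hom.hom
              (((φ.pullbackFunctor.obj A).ψ (bf 0) v₀' (hbf 0)).hom.hom.hom z))) := rfl
    have c1 : ∀ w : (A.T (𝔊.toAnabelioids.graph.edgeOf b₁t)).obj.V,
        (A.ψ b₁t v₀ hb₁t).hom.hom.hom ((A.ψ b₁t v₀ hb₁t).inv.hom.hom w) = w :=
      fun w => congrArg (fun q => q.hom.hom w) (A.ψ b₁t v₀ hb₁t).inv_hom_id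
    have c2 : ∀ w : (A.S v₀).obj.V,
        (A.ψ b₁f v₀ hb₁f).inv.hom.hom ((A.ψ b₁f v₀ hb₁f).hom.hom.hom w) = w :=
      fun w => congrArg (fun q => q.hom.hom w) (A.ψ b₁f v₀ hb₁f).hom_inv_id
    rw [e1, g0f, g0t, g1t, g1f]
    simp only [inv_one, one_smul, c1, c2]
  -- hence `ι(x)` = "act by `k⁻¹`" ∈ `Π_v`
  obtain ⟨eK, heK⟩ := exists_continuousMulEquiv_aut_forget (G := Multiplicative (ZMod 2))
  have hy : ι x = 𝔊.toAnabelioids.piVToPi v₀ F (eK k⁻¹) := by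
    apply Iso.ext
    apply NatTrans.ext
    funext A
    apply FintypeCat.hom_ext
    intro z
    rw [key A z, pi1Map_hom_app, heK]
    rfl
  have hmem : ι x ∈ ι.range ⊓ (𝔊.toAnabelioids.piVToPi v₀ F).range :=
    Subgroup.mem_inf.mpr ⟨MonoidHom.mem_range.mpr ⟨x, rfl⟩, MonoidHom.mem_range.mpr ⟨eK k⁻¹, hy.symm⟩⟩
  -- by clause (a), `ι(x) ∈ ι(Π_{v′})`, all of whose elements are trivial (`φ_v` is trivial)
  have hmem' : ι x ∈ (ι.comp (𝔊'.toAnabelioids.piVToPi v₀' F')).range := ha ▸ hmem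
  obtain ⟨σ', hσ'⟩ := MonoidHom.mem_range.mp hmem'
  obtain ⟨h', rfl⟩ := eK.surjective σ'
  have htriv : (ι.comp (𝔊'.toAnabelioids.piVToPi v₀' F')) (eK h') = 1 := by
    apply Iso.ext
    apply NatTrans.ext
    funext A
    apply FintypeCat.hom_ext
    intro z
    have e2 : (((ι.comp (𝔊'.toAnabelioids.piVToPi v₀' F')) (eK h')).hom.app A) z =
        ((eK h').hom.app ((φ.φV v₀').pullback.obj (A.S v₀))) z := rfl
    rw [e2, heK]
    change ((A.S v₀).obj.ρ 1).hom z = z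
    rw [map_one]
    rfl
  have h1 : 𝔊.toAnabelioids.piVToPi v₀ F (eK k⁻¹) = 1 := by rw [← hy, ← hσ', htriv]
  -- evaluate at the object of `B(𝒢)` with vertex datum `X` and identity gluings: `k⁻¹` acts trivially
  have hX : ∀ X : BCat (Multiplicative (ZMod 2)), X.obj.ρ k⁻¹ = 𝟙 _ := by
    intro X
    let AX : 𝔊.toAnabelioids.BObj :=
      { S := fun _ => X
        T := fun _ => (𝔊.toAnabelioids.pull b₁f v₀ hb₁f).pullback.obj X
        ψ := fun _ _ _ => Iso.refl _ }
    have := congrArg (fun σ => σ.hom.app AX) h1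
    rw [pi1Map_hom_app, heK] at this
    exact this
  have hk' : eK k⁻¹ = 1 := aut_forget_eq_of_app_eq _ _ (fun X => by rw [heK, hX]; rfl)
  exact hk (inv_eq_one.mp (eK.injective (hk'.trans (map_one eK).symm)))

end SemiGraphOfAnabelioids

end Literature.AnabelianGeometry.SemiGraphs
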